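import Mathlib
import Summits.ResolutionOfSingularities.ResolutionOfSingularities.Theorems.RadicialJungCleanModelsCleanLU3ArcCoreFinal
import Summits.ResolutionOfSingularities.ResolutionOfSingularities.Theorems.RadicialJungCleanModelsCleanLU3ArcWrapPrelims
import Summits.ResolutionOfSingularities.ResolutionOfSingularities.Theorems.RadicialJungCleanModelsCleanLU3ArcPackage
import Summits.ResolutionOfSingularities.ResolutionOfSingularities.Theorems.RadicialJungCleanModelsCleanSpreadsDualDerivations
import Literature.AlgebraicGeometry.Resolution.DerivativeIdealsLocalization
import Literature.AlgebraicGeometry.Resolution.TranscendenceDefect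
import HarnessLib

/-!
# Route `RadicialJung`, crux `CleanModels` (stmt-15917), stub `stub_cleanLU3DefectArcInfinite`: **CLASS (A) WITH PERFECT RESIDUE
# FIELDS IS DISCHARGED — arbitrary (infinite) residue towers**

Line `Sketch` rev 20 of crux stmt-ResolutionOfSingularities-15917; lead `res-B-lead-1` g3.  OURS; nothing here proves resolution in
characteristic `p`.

`cleanLU3Defect_of_discrete_of_perfectResidues`: the rev-18 data of `stub_cleanLU3Defect` (zero-dimensional `O ⊇ A`, `A` finitely
generated over `k` with `Frac A = K`, `locAtCentre A O` regular of dimension `3`, `g₀ ∉ K^p` without best `p`-th-power approximation)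
PLUS (i) `O` discrete of rank one (a value-generator `π`), (ii) a derivation `D` of `K` with `D g₀ ≠ 0` and `s • D` preserving `A`,
(iii) PERFECT RESIDUE FIELDS: every element of every intermediate ring `A ⊆ T ⊆ O` is a `p`-th power modulo the centre of `O` (true
whenever `k` is perfect) — give the conclusion of the stub in loose clean form (1) (`π · f₁` with `(π, f₁, t₃)` a regular system of
parameters), with NO hypothesis on the residue tower of `O`.  This is res-B-lens-5 g6's hand proof `CLASSA-rational-arcs-lens5.md` §7,
made algebraic (`Q`-constants instead of coefficient fields) and kernel-checked: quadratic sequence package ✓, exhaustion ✓, dual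
derivations of the finitely generated model at the regular closed centre (✓ `exists_derivations_dual_of_finiteType`, any ground field)
extended to `K` (✓ `exists_derivation_extend_of_isLocalization`), some dual derivative of `h = b^p g₀` nonzero (✓ `exists_dual_apply_ne_zero`),
then ✓ `arc_infinite_core`.
-/

noncomputable section

set_option linter.dupNamespace false -- mandated namespace of this single-conjunct summit

open IsLocalRing Polynomial
open Literature.AlgebraicGeometry.Resolution

namespace Summit.ResolutionOfSingularities.ResolutionOfSingularities.Theorems.RadicialJung.CleanModels

variable {k K : Type} [Field k] [Field K] [Algebra k K]

/-- Reading the output of `arc_infinite_core` at a finitely generated model as the conclusion of the stub (form (1): `1 · π¹ · f₁¹`).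
[folklore] -/
theorem conclusion_of_core_formOne {p : ℕ} [hp : Fact p.Prime] [CharP K p] {O : ValuationSubring K} {A A' : Subalgebra k K}
    (hA'O : A'.toSubring ≤ O.toSubring) (hAA' : A ≤ A') (hA'fg : A'.FG)
    (Rn : Subring K) [IsLocalRing Rn] (hreg : IsRegularLocalRing Rn) (hdim : ringKrullDim Rn = 3)
    (hRn : Rn = locAtCentre A'.toSubring O)
    (g₀ b c π f₁ t₃ : K) (hb : b ≠ 0) (hπ0 : π ≠ 0) (L : ℕ) (hf₁ : f₁ ∈ Rn) (ht₃ : t₃ ∈ Rn) (hπn : π ∈ Rn)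
    (hspan : maximalIdeal Rn = Ideal.span {(⟨π, hπn⟩ : Rn), ⟨f₁, hf₁⟩, ⟨t₃, ht₃⟩})
    (hrep : (b ^ p * g₀ - c ^ p) / π ^ (p * L) = π * f₁) :
    ∃ (A' : Subalgebra k K), A'.toSubring ≤ O.toSubring ∧ A ≤ A' ∧ A'.FG ∧
    ∃ (_ : IsRegularLocalRing (locAtCentre A'.toSubring O)) (c : Fin p → K), (∃ j : Fin p, (j : ℕ) ≠ 0 ∧ c j ≠ 0) ∧
    ((∃ (d m : ℕ) (hmd : m ≤ d) (t : Fin d → ↥(locAtCentre A'.toSubring O)) (a : Fin m → ℕ) (u : ↥(locAtCentre A'.toSubring O)), IsUnit u ∧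
    Ideal.span (Set.range t) = IsLocalRing.maximalIdeal ↥(locAtCentre A'.toSubring O) ∧
    ringKrullDim ↥(locAtCentre A'.toSubring O) = (d : WithBot ℕ∞) ∧ 0 < m ∧ (∀ i, ¬ p ∣ a i) ∧
    (∑ j : Fin p, c j ^ p * g₀ ^ (j : ℕ)) = (u : K) * ∏ i : Fin m, ((t (Fin.castLE hmd i) : ↥(locAtCentre A'.toSubring O)) : K) ^ (a i)) ∨
    (∃ u : ↥(locAtCentre A'.toSubring O), IsUnit u ∧ (∑ j : Fin p, c j ^ p * g₀ ^ (j : ℕ)) = (u : K) ∧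
    ∀ c' : ↥(locAtCentre A'.toSubring O), u - c' ^ p ∉ IsLocalRing.maximalIdeal ↥(locAtCentre A'.toSubring O)) ∨
    (∃ s c' : ↥(locAtCentre A'.toSubring O), (∑ j : Fin p, c j ^ p * g₀ ^ (j : ℕ)) = (s : K) ∧
    s - c' ^ p ∈ IsLocalRing.maximalIdeal ↥(locAtCentre A'.toSubring O) ∧
    s - c' ^ p ∉ IsLocalRing.maximalIdeal ↥(locAtCentre A'.toSubring O) ^ 2)) := by
  classical
  subst hRn
  refine ⟨A', hA'O, hAA', hA'fg, hreg,
    fun j : Fin p => if (j : ℕ) = 0 then -c / π ^ L else if (j : ℕ) = 1 then b / π ^ L else 0, ?_, Or.inl ?_⟩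
  · refine ⟨⟨1, hp.out.one_lt⟩, one_ne_zero, ?_⟩
    simp only [one_ne_zero, if_false, if_true]
    exact div_ne_zero hb (pow_ne_zero _ hπ0)
  · refine ⟨3, 2, by norm_num, ![⟨π, hπn⟩, ⟨f₁, hf₁⟩, ⟨t₃, ht₃⟩], ![1, 1], 1, isUnit_one, ?_, hdim, by norm_num, ?_, ?_⟩
    · rw [hspan]
      congr 1
      ext x
      simp only [Set.mem_range, Set.mem_insert_iff, Set.mem_singleton_iff]
      constructor
      · rintro ⟨i, rfl⟩; fin_cases i <;> simp
      · rintro (rfl | rfl | rfl)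
        exacts [⟨0, rfl⟩, ⟨1, rfl⟩, ⟨2, rfl⟩]
    · intro i; fin_cases i <;> simp [hp.out.one_lt.ne', Nat.dvd_one]
    · rw [sum_rep_eq, hrep]
      simp [Fin.prod_univ_two]

/-- **Class (A) with perfect residue fields is discharged (any residue tower).**  See the module docstring. [folklore] -/
theorem cleanLU3Defect_of_discrete_of_perfectResidues :
    ∀ (p : ℕ), p.Prime →
    ∀ (k : Type) [Field k] [CharP k p] (K : Type) [Field K] [Algebra k K]
    (O : ValuationSubring K) (A : Subalgebra k K), A.toSubring ≤ O.toSubring → A.FG → IsFractionRing A K →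
    ringKrullDim A ≤ 3 → IsRegularLocalRing (locAtCentre A.toSubring O) →
    ringKrullDim (locAtCentre A.toSubring O) = 3 →
    (∀ (T : Subring K) (hT : T ≤ O.toSubring), A.toSubring ≤ T → (subringCentre T O hT).IsMaximal) →
    ∀ g₀ : K, (∀ c : K, c ^ p ≠ g₀) →
    (∀ f₀ : K, ∃ f₁ : K, O.valuation (g₀ - f₁ ^ p) < O.valuation (g₀ - f₀ ^ p)) →
    (∀ hk : ∀ c : k, algebraMap k K c ∈ O, transcendenceDefect k O hk ≠ 0) →
    -- class (A); derivation; perfect residue fields: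
    (∃ π : K, π ≠ 0 ∧ (∀ x : K, O.valuation x < 1 → O.valuation x ≤ O.valuation π) ∧
      (∀ x : K, x ≠ 0 → ∃ n : ℕ, O.valuation π ^ n ≤ O.valuation x)) →
    (∃ (D : Derivation ℤ K K) (s : K), s ≠ 0 ∧ (∀ y : K, y ∈ A → s * D y ∈ A) ∧ D g₀ ≠ 0) →
    (∀ (T : Subring K), T ≤ O.toSubring → A.toSubring ≤ T → ∀ r : K, r ∈ T → ∃ t : K, t ∈ T ∧ O.valuation (r - t ^ p) < 1) →
    ∃ (A' : Subalgebra k K), A'.toSubring ≤ O.toSubring ∧ A ≤ A' ∧ A'.FG ∧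
    ∃ (_ : IsRegularLocalRing (locAtCentre A'.toSubring O)) (c : Fin p → K), (∃ j : Fin p, (j : ℕ) ≠ 0 ∧ c j ≠ 0) ∧
    ((∃ (d m : ℕ) (hmd : m ≤ d) (t : Fin d → ↥(locAtCentre A'.toSubring O)) (a : Fin m → ℕ) (u : ↥(locAtCentre A'.toSubring O)), IsUnit u ∧
    Ideal.span (Set.range t) = IsLocalRing.maximalIdeal ↥(locAtCentre A'.toSubring O) ∧
    ringKrullDim ↥(locAtCentre A'.toSubring O) = (d : WithBot ℕ∞) ∧ 0 < m ∧ (∀ i, ¬ p ∣ a i) ∧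
    (∑ j : Fin p, c j ^ p * g₀ ^ (j : ℕ)) = (u : K) * ∏ i : Fin m, ((t (Fin.castLE hmd i) : ↥(locAtCentre A'.toSubring O)) : K) ^ (a i)) ∨
    (∃ u : ↥(locAtCentre A'.toSubring O), IsUnit u ∧ (∑ j : Fin p, c j ^ p * g₀ ^ (j : ℕ)) = (u : K) ∧
    ∀ c' : ↥(locAtCentre A'.toSubring O), u - c' ^ p ∉ IsLocalRing.maximalIdeal ↥(locAtCentre A'.toSubring O)) ∨
    (∃ s c' : ↥(locAtCentre A'.toSubring O), (∑ j : Fin p, c j ^ p * g₀ ^ (j : ℕ)) = (s : K) ∧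
    s - c' ^ p ∈ IsLocalRing.maximalIdeal ↥(locAtCentre A'.toSubring O) ∧
    s - c' ^ p ∉ IsLocalRing.maximalIdeal ↥(locAtCentre A'.toSubring O) ^ 2)) := by
  intro p hp k _ _ K _ _ O A hAO hAfg hfrac _ hreg hdim3 hzd g₀ _ hdefect _ ⟨π, hπ0, hπ, harch⟩ ⟨D, s, hs0, hDA, hDg⟩ hperfT
  classical
  haveI : Fact p.Prime := ⟨hp⟩
  haveI : CharP K p := charP_of_injective_algebraMap (algebraMap k K).injective p
  -- (0) the quadratic sequence package
  have hd : ringKrullDim (locAtCentre A.toSubring O) ≠ 0 := by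
    intro h0; rw [hdim3] at h0; exact absurd h0 (by decide)
  obtain ⟨R, hR0, hstep, hregR, hdimR, hmodel⟩ := exists_quadraticSeq_package A O hAO hAfg hreg hd hzd
  haveI hRloc : ∀ i, IsLocalRing (R i) := fun i => by haveI := hregR i; infer_instance
  have h0dom : SubringDominates (R 0) O.toSubring := by rw [hR0]; exact subringDominates_locAtCentre hAO
  have hdom : ∀ i, SubringDominates (R i) O.toSubring := fun i => (sequence_dominates h0dom hstep i).1
  have hmono : ∀ {i j : ℕ}, i ≤ j → R i ≤ R j := fun hij => sequence_monotone hstep hij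
  have hof : IsLocalRingOf (R 0) := by rw [hR0]; exact isLocalRingOf_locAtCentre A O hAO
  have hdim3R : ∀ i, ringKrullDim (R i) = 3 := fun i => (hdimR i).trans hdim3
  have hAR0 : A.toSubring ≤ R 0 := by rw [hR0]; exact le_locAtCentre _ O
  have hmemR : ∀ i (a : R i), a ∈ maximalIdeal (R i) ↔ O.valuation (a : K) < 1 := fun i =>
    (subringDominates_valuationSubring_iff (hdom i).1).mp (hdom i)
  have hperfR : ∀ (i : ℕ) (b : K), b ∈ R i → ∃ t : K, t ∈ R i ∧ O.valuation (b - t ^ p) < 1 := fun i =>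
    hperfT (R i) (hdom i).1 (hAR0.trans (hmono (Nat.zero_le i)))
  have hperfO : ∀ b : K, b ∈ O → ∃ t : K, t ∈ O ∧ O.valuation (b - t ^ p) < 1 := fun b hb =>
    hperfT O.toSubring le_rfl hAO b hb
  -- (1) `h = b^p g₀ ∈ A`
  obtain ⟨a₀, b, hb, hab⟩ := IsFractionRing.div_surjective (A := A) g₀
  have hab' : (a₀ : K) / (b : K) = g₀ := hab
  have hb0 : (b : K) ≠ 0 := fun h => nonZeroDivisors.ne_zero hb (Subtype.ext h)
  set h : K := (b : K) ^ p * g₀ with hhdef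
  have hhA : h ∈ A := by
    have : h = (a₀ : K) * (b : K) ^ (p - 1) := by
      obtain ⟨q, hq⟩ : ∃ q, p = q + 1 := ⟨p - 1, (Nat.sub_add_cancel hp.one_lt.le).symm⟩
      rw [hhdef, ← hab', hq, Nat.add_sub_cancel, pow_succ]
      field_simp
    rw [this]
    exact A.mul_mem a₀.2 (A.pow_mem b.2 _)
  have hvh1 : O.valuation h ≤ 1 := (O.valuation_le_one_iff _).mpr (hAO hhA)
  have happrox : ∀ N : ℕ, ∃ bb : K, O.valuation (h - bb ^ p) ≤ O.valuation π ^ N :=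
    forall_exists_valuation_sub_pow_le O π hp.ne_zero hπ g₀ (b : K) hdefect hvh1
  -- `v π < 1`
  have hne0 : maximalIdeal (R 0) ≠ ⊥ := by
    intro hbot
    have hfield : IsField (R 0) := IsLocalRing.isField_iff_maximalIdeal_eq.mpr hbot
    have h0 : ringKrullDim (R 0) = 0 := ringKrullDim_eq_zero_of_isField hfield
    rw [hdim3R] at h0; exact absurd h0 (by decide)
  obtain ⟨m₀, hm₀m, hm₀0⟩ := Submodule.exists_mem_ne_zero_of_ne_bot hne0
  have hvπ : O.valuation π < 1 := by
    have hvm : O.valuation (m₀ : K) < 1 := (hmemR 0 m₀).mp hm₀m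
    obtain ⟨n, hn⟩ := harch _ (fun h0 => hm₀0 (Subtype.ext h0))
    by_contra hge
    push Not at hge
    exact absurd ((one_le_pow₀ (M₀ := O.ValueGroup) hge).trans hn) (not_le.mpr hvm)
  have hπO : π ∈ O := by rw [← O.valuation_le_one_iff]; exact hvπ.le
  have hvπpos : 0 < O.valuation π := zero_lt_iff.mpr ((Valuation.ne_zero_iff _).mpr hπ0)
  -- (2) transport of the derivation; (3) climb until `π` is absorbed
  have hD0 : ∀ y ∈ R 0, s * D y ∈ R 0 := by
    rw [hR0]; exact mul_derivation_mem_locAtCentre D s (B := A.toSubring) (O := O) (fun y hy => hDA y hy)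
  have hDer := exists_derivation_preserving_seq R hstep D s hs0 hD0
  obtain ⟨n₁, hπn₁⟩ := exists_mem_of_quadraticTransforms_of_discrete O R hof h0dom hstep π hπ harch π hπO
  -- the restarted sequence
  let R' : ℕ → Subring K := fun i => R (n₁ + i)
  haveI hR'loc : ∀ i, IsLocalRing (R' i) := fun i => hRloc (n₁ + i)
  have hstep' : ∀ i, IsQuadraticTransformAlong O (R' i) (R' (i + 1)) := fun i => by
    change IsQuadraticTransformAlong O (R (n₁ + i)) (R (n₁ + (i + 1))); rw [← add_assoc]; exact hstep (n₁ + i)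
  have hreg' : ∀ i, IsRegularLocalRing (R' i) := fun i => hregR (n₁ + i)
  have hdim' : ∀ i, ringKrullDim (R' i) = 3 := fun i => hdim3R (n₁ + i)
  have h0' : SubringDominates (R' 0) O.toSubring := hdom (n₁ + 0)
  have hperf' : ∀ (i : ℕ) (b : K), b ∈ R' i → ∃ t : K, t ∈ R' i ∧ O.valuation (b - t ^ p) < 1 := fun i => hperfR (n₁ + i)
  -- (4) a regular system of parameters `(π, y, z)` of `R n₁`
  haveI : IsRegularLocalRing (R n₁) := hregR n₁
  obtain ⟨x, hx⟩ := exists_regularSystemOfParameters (R := R n₁)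
  have hsf : (maximalIdeal (R n₁)).spanFinrank = 3 := by
    have e := IsRegularLocalRing.spanFinrank_maximalIdeal (R := R n₁)
    rw [hdim3R] at e; exact_mod_cast e
  let x' : Fin 3 → R n₁ := fun j => x (Fin.cast hsf.symm j)
  have hx' : maximalIdeal (R n₁) = Ideal.span {x' 0, x' 1, x' 2} := by
    rw [← hx]
    have hr : Set.range x = Set.range x' := by
      ext t
      simp only [Set.mem_range, x']
      constructor
      · rintro ⟨i, rfl⟩; exact ⟨Fin.cast hsf i, by simp⟩
      · rintro ⟨j, rfl⟩; exact ⟨Fin.cast hsf.symm j, rfl⟩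
    rw [hr]
    congr 1
    ext t
    simp only [Set.mem_range, Set.mem_insert_iff, Set.mem_singleton_iff]
    constructor
    · rintro ⟨i, rfl⟩; fin_cases i <;> simp
    · rintro (rfl | rfl | rfl)
      exacts [⟨0, rfl⟩, ⟨1, rfl⟩, ⟨2, rfl⟩]
  have hπm : (⟨π, hπn₁⟩ : R n₁) ∈ maximalIdeal (R n₁) := (hmemR n₁ _).mpr hvπ
  have hπm2 : (⟨π, hπn₁⟩ : R n₁) ∉ maximalIdeal (R n₁) ^ 2 := by
    intro h2
    have hle := valuation_le_sq_of_mem_sq (hdom n₁) π hπ _ h2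
    change O.valuation π ≤ O.valuation π ^ 2 at hle
    rw [pow_two] at hle
    have : O.valuation π * 1 ≤ O.valuation π * O.valuation π := by rwa [mul_one]
    exact absurd (le_of_mul_le_mul_left this hvπpos) (not_le.mpr hvπ)
  obtain ⟨y, z, -, -, hmyz⟩ := exists_span_triple_of_not_mem_sq (x' 0) (x' 1) (x' 2) ⟨π, hπn₁⟩ hx' hπm hπm2
  -- (5) a finitely generated model `A₂` of `R n₁` containing `π, y, z`
  obtain ⟨A₁, hA₁O, hAA₁, hA₁fg, hRA₁⟩ := hmodel n₁
  obtain ⟨A₂, hA₂sub, hA₁A₂, hA₂fg'⟩ := exists_subalgebra_closure A₁ {π, (y : K), (z : K)}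
  have hA₂fg : A₂.FG := hA₂fg' hA₁fg
  have hA₂R : A₂.toSubring ≤ R n₁ := by
    rw [hA₂sub, Subring.closure_le]
    rintro w (hw | hw)
    · rw [hRA₁]; exact le_locAtCentre _ O hw
    · simp only [Finset.coe_insert, Finset.coe_singleton, Set.mem_insert_iff, Set.mem_singleton_iff] at hw
      rcases hw with rfl | rfl | rfl
      exacts [hπn₁, y.2, z.2]
  have hA₂O : A₂.toSubring ≤ O.toSubring := hA₂R.trans (hdom n₁).1
  have hRA₂ : R n₁ = locAtCentre A₂.toSubring O := by
    apply le_antisymm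
    · rw [hRA₁]; exact locAtCentre_mono O (fun w hw => hA₁A₂ hw)
    · have := locAtCentre_mono O hA₂R
      rwa [hRA₁, locAtCentre_locAtCentre, ← hRA₁] at this
  have hπA₂ : π ∈ A₂ := by
    change π ∈ A₂.toSubring; rw [hA₂sub]; exact Subring.subset_closure (Or.inr (by simp))
  have hyA₂ : (y : K) ∈ A₂ := by
    change (y : K) ∈ A₂.toSubring; rw [hA₂sub]; exact Subring.subset_closure (Or.inr (by simp))
  have hzA₂ : (z : K) ∈ A₂ := by
    change (z : K) ∈ A₂.toSubring; rw [hA₂sub]; exact Subring.subset_closure (Or.inr (by simp))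
  -- (6) dual derivations of `A₂` at the centre, extended to `K`
  letI : Algebra k A₂.toSubring := inferInstanceAs (Algebra k A₂)
  haveI : Algebra.FiniteType k A₂.toSubring := (A₂.fg_iff_finiteType.mp hA₂fg : Algebra.FiniteType k A₂)
  haveI := isLocalization_locAtCentre (K := K) (O := O) hA₂O
  haveI hmax : (subringCentre A₂.toSubring O hA₂O).IsMaximal := hzd A₂.toSubring hA₂O (fun w hw => hA₁A₂ (hAA₁ hw))
  haveI hregL : IsRegularLocalRing (locAtCentre A₂.toSubring O) := by rw [← hRA₂]; exact hregR n₁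
  let av : Fin 3 → A₂.toSubring := ![⟨π, hπA₂⟩, ⟨y, hyA₂⟩, ⟨z, hzA₂⟩]
  have hav : ∀ l, ((av l : A₂.toSubring) : K) = (![π, (y : K), (z : K)] : Fin 3 → K) l := by
    intro l; fin_cases l <;> rfl
  have hspanL : Ideal.span (Set.range fun l => algebraMap A₂.toSubring (locAtCentre A₂.toSubring O) (av l)) =
      maximalIdeal (locAtCentre A₂.toSubring O) := by
    have hT := maximalIdeal_eq_span_of_eq hRA₂ π y z hπn₁ y.2 z.2 hmyz
    rw [hT]
    congr 1
    ext w
    simp only [Set.mem_range, Set.mem_insert_iff, Set.mem_singleton_iff]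
    constructor
    · rintro ⟨l, rfl⟩
      fin_cases l
      · exact Or.inl (Subtype.ext rfl)
      · exact Or.inr (Or.inl (Subtype.ext rfl))
      · exact Or.inr (Or.inr (Subtype.ext rfl))
    · rintro (rfl | rfl | rfl)
      · exact ⟨0, Subtype.ext rfl⟩
      · exact ⟨1, Subtype.ext rfl⟩
      · exact ⟨2, Subtype.ext rfl⟩
  have hdimL : ringKrullDim (locAtCentre A₂.toSubring O) = 3 := ringKrullDim_eq_of_subring_eq hRA₂ (hdim3R n₁)
  obtain ⟨E, e₀, he₀, hdualB⟩ := exists_derivations_dual_of_finiteType k (B := A₂.toSubring)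
    (subringCentre A₂.toSubring O hA₂O) (locAtCentre A₂.toSubring O) av hspanL hdimL
  -- extend to `K`
  haveI : IsFractionRing A₂.toSubring K := (isFractionRing_of_le (hAA₁.trans hA₁A₂) hfrac : IsFractionRing A₂ K)
  have hext : ∀ l, ∃ D' : Derivation ℤ K K, ∀ w : A₂.toSubring, D' (w : K) = ((E l w : A₂.toSubring) : K) := fun l =>
    exists_derivation_extend_of_isLocalization ℤ K (nonZeroDivisors A₂.toSubring) (E l)
  choose D' hD' using hext
  have hD'A : ∀ l w, w ∈ A₂.toSubring → (1 : K) * D' l w ∈ A₂.toSubring := fun l w hw => by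
    rw [one_mul, hD' l ⟨w, hw⟩]; exact (E l ⟨w, hw⟩).2
  have hE' : ∀ l w, w ∈ R' 0 → D' l w ∈ R' 0 := by
    intro l w hw
    change w ∈ R n₁ at hw
    rw [hRA₂] at hw
    have := mul_derivation_mem_locAtCentre (D' l) 1 (B := A₂.toSubring) (O := O) (hD'A l) w hw
    rw [one_mul] at this
    change D' l w ∈ R n₁; rw [hRA₂]; exact this
  have hve₀ : O.valuation ((e₀ : A₂.toSubring) : K) = 1 := valuation_eq_one_of_not_mem_subringCentre hA₂O he₀
  let a : Fin 3 → K := ![π, (y : K), (z : K)]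
  have haR : ∀ l, a l ∈ R' 0 := by
    intro l; change a l ∈ R n₁; fin_cases l
    exacts [hπn₁, y.2, z.2]
  have hdual : ∀ l m, D' l (a m) = if l = m then ((e₀ : A₂.toSubring) : K) else 0 := by
    intro l m
    have : a m = ((av m : A₂.toSubring) : K) := (hav m).symm
    rw [this, hD' l (av m), hdualB l m]
    split_ifs <;> rfl
  have hma : maximalIdeal (R' 0) = Ideal.span (Set.range fun l => (⟨a l, haR l⟩ : R' 0)) := by
    change maximalIdeal (R n₁) = _
    rw [hmyz]
    congr 1
    ext w
    simp only [Set.mem_range, Set.mem_insert_iff, Set.mem_singleton_iff]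
    constructor
    · rintro (rfl | rfl | rfl)
      · exact ⟨0, rfl⟩
      · exact ⟨1, Subtype.ext rfl⟩
      · exact ⟨2, Subtype.ext rfl⟩
    · rintro ⟨l, rfl⟩
      fin_cases l
      · exact Or.inl rfl
      · exact Or.inr (Or.inl (Subtype.ext rfl))
      · exact Or.inr (Or.inr (Subtype.ext rfl))
  -- (7) some dual derivative of `h` is nonzero
  obtain ⟨s₁, hs₁0, hD₁⟩ := hDer n₁
  have hhR : h ∈ R' 0 := hmono (Nat.zero_le n₁) (hAR0 hhA)
  have hDh' : D h = (b : K) ^ p * D g₀ := by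
    rw [hhdef, Derivation.leibniz, Derivation.leibniz_pow]
    simp [smul_eq_mul, nsmul_eq_mul]
  have hDh : s₁ * D h ≠ 0 := mul_ne_zero hs₁0 (by rw [hDh']; exact mul_ne_zero (pow_ne_zero _ hb0) hDg)
  have hEh : ∃ l, D' l h ≠ 0 :=
    exists_dual_apply_ne_zero (hdom n₁) π hπ harch hvπ hπ0 a haR hma (hperfR n₁) D' hE' _ hve₀ hdual D s₁ hD₁ h hhR hDh
  -- (8) the core
  obtain ⟨n, L, c, f₁, t₃, hf₁, ht₃, hπn, hspan, hrepr⟩ :=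
    arc_infinite_core (O := O) (p := p) R' hreg' hdim' h0' hstep' π hπn₁ hπ0 hvπ hπ harch a haR rfl hma hperf' hperfO
      D' hE' _ hve₀ hdual h hhR hEh happrox
  -- (9) the model of `R (n₁ + (n + 1))` and the conclusion
  obtain ⟨A', hA'O, hAA', hA'fg, hRn⟩ := hmodel (n₁ + (n + 1))
  exact conclusion_of_core_formOne hA'O hAA' hA'fg (R' (n + 1)) (hreg' (n + 1)) (hdim' (n + 1)) hRn g₀ (b : K) c π f₁ t₃
    hb0 hπ0 L hf₁ ht₃ hπn hspan (by rw [← hrepr])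

end Summit.ResolutionOfSingularities.ResolutionOfSingularities.Theorems.RadicialJung.CleanModels

end
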